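import Literature.AnabelianGeometry.EtaleTheta.MuTwoSettingInversionEll
import Literature.AnabelianGeometry.EtaleTheta.Discharge.Sec2ThetaSubquotientNormal
import Literature.AnabelianGeometry.EtaleTheta.Discharge.Sec2DtpYThetaAbelianCorollaries
import Literature.AnabelianGeometry.EtaleTheta.Discharge.Sec1DeltaThetaTateTwist
import HarnessLib

/-!
# [EtTh] §2 over §1 at the C-level: `Δ^tp_C` acts TRIVIALLY on `l·Δ_Θ`, and `Π^tp_C` acts on `l·Δ_Θ ⊗ ℤ/N = μ_N`
# through the cyclotomic character (proof-only; inputs BY NAME)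

Mochizuki, *The étale theta function and its Frobenioid-theoretic manifestations*, Publ. RIMS **45** (2009)
[EtTh]: §1 p. 12 («`Δ^Θ_X := Δ_X/[Δ_X,[Δ_X,Δ_X]]`, `Δ_Θ := [Δ^Θ_X, Δ^Θ_X] (≅ Ẑ(1))`»), §2 Prop. 2.2 (i) p. 37
(«eigenvalues `−1` and `1`» of the inversion `ι` on `Δ̄^ell_X`, `Δ̄_Θ`), Def. 2.7 p. 41, Cor. 2.19 (i) p. 64
[cite: MochizukiEtTh2009, Prop 2.2 (i) p.37]; used by [IUTchII] Rmk. 1.1.1 (iv) (kurims p. 23: «the natural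
conjugation action … coincides with the action of `G(M)` via the cyclotomic character»).

Cell abc-iut, seat abc-iut-w4-d018 (gen 6), row «G-w4d043-2 FLSYMMETRY-GENUINE» (L6-lead §F v1.19au), L2-side
helper file, PROOF-ONLY (0 `def`), over abc-iut-L2-d3's C-level record `cl : M.CLevelData` (`conjX g` = the inner
automorphism of `Π^tp_C` by `g` restricted to `Π^tp_X`):
* bookkeeping `conjX_mul` / `conjX_one` / `conjX_symm_apply`, stability of `Ker(↠ Θ)` and of the
  `(l·Δ_Θ)`-preimage under `conjX g` (abc-iut-L2-d3's `map_ker_toTheta_eq` / `map_comap_lDeltaTheta_eq`);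
* **`toTheta_conjX_commutator_eq`** — a GEOMETRIC `g ∈ Π^tp_C` (`augC g = 1`) FIXES `θ(z b z⁻¹ b⁻¹)`, `z, b ∈ Δ^tp_X`:
  for `g ∈ Π^tp_X` by centrality of `Δ_Θ` in `(Δ^tp_X)^Θ` (root field); for `g ∉ Π^tp_X` from abc-iut-L2-t1's census
  predicate C4 `InvActsByNegOnEllAt` («`ε_±` acts by `−1` on `(Δ^tp_X)^ell`», a hypothesis BY NAME) and the class-two
  identity `[u x⁻¹, v y⁻¹] = [x, y]` — the printed «eigenvalue `1` on `Δ_Θ`» DERIVED from «eigenvalue `−1` on `Δ^ell`»;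
* at abc-iut-L2-t8's model `R := C.rigidData μ hC hS h15 L` of `X̲̲` (Heisenberg normal form `rigidData_hcomm_of_origin`,
  inputs `IsEtThOrigin`, `hYcl`): **`toTheta_conjX_eq_of_mem_lDeltaTheta`** (`Δ^tp_C` acts trivially on the
  `(l·Δ_Θ)`-preimage), **`thetaMod_conjX_eq`** (for EVERY `g ∈ Π^tp_C`, `(l·Δ_Θ) ↠ μ_N` intertwines `conjX g` with the
  Galois action of `augC g` — the cyclotomic character), and membership lemmas under the side condition
  `hker : Ker(Π^tp_X ↠ (Π^tp_X)^Θ) ≤ Π^tp_X̲̲` (abc-iut-w5-d165's binder, `Sec2InertiaOntoDeltaTheta`).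
BINDER CENSUS: C4, `IsEtThOrigin`, `hYcl`, `hker` — existing binders BY NAME; no `Prop` fact introduced, no
FACT-LIST row consumed. HONEST FRAMING: kernel facts about the cell's typed interfaces; [EtTh] is refereed and typed,
not endorsed; no side taken on [IUTchIII] Cor. 3.12; typed ≠ proved.
-/

noncomputable section

namespace Literature.AnabelianGeometry.EtaleTheta

open Literature.AnabelianGeometry.SemiGraphs
open scoped Pointwise commutatorElement

variable {p : ℕ} [Fact p.Prime]

/-! ## A class-two commutator identity -/

/-- In any group: if `u`, `v` commute with `x`, `y` and with each other, and the commutator `x y x⁻¹ y⁻¹`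
commutes with `x` and `y`, then `[u x⁻¹, v y⁻¹] = [x, y]` — the class-two computation behind «eigenvalues `−1`
and `1`» of [EtTh] Prop. 2.2 (i) (the inversion acts by `−1` on `Δ̄^ell_X` and trivially on `Δ̄_Θ = [Δ̄^Θ_X, Δ̄^Θ_X]`).
[cite: MochizukiEtTh2009, Prop 2.2 (i) p.37] -/
theorem commutator_central_twist_inv {G : Type*} [Group G] {x y u v : G}
    (hux : Commute u x) (huy : Commute u y) (hvx : Commute v x) (hvy : Commute v y) (huv : Commute u v)
    (htx : Commute (x * y * x⁻¹ * y⁻¹) x) (hty : Commute (x * y * x⁻¹ * y⁻¹) y) :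
    (u * x⁻¹) * (v * y⁻¹) * (u * x⁻¹)⁻¹ * (v * y⁻¹)⁻¹ = x * y * x⁻¹ * y⁻¹ := by
  set t := x * y * x⁻¹ * y⁻¹ with ht
  have hxy : x * y = t * (y * x) := by rw [ht]; group
  -- right-associate and bubble `u`, then `v`, to their inverses
  simp only [mul_inv_rev, inv_inv, mul_assoc]
  rw [(hux.inv_right).left_comm, huv.left_comm, (huy.inv_right).left_comm, hux.left_comm,
    mul_inv_cancel_left, (hvy.inv_right).left_comm, hvx.left_comm, hvy.left_comm, mul_inv_cancel,
    mul_one]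
  -- `x⁻¹ y⁻¹ x y = t` since `t` commutes with `x`, `y`
  rw [hxy, (hty.inv_right).symm.left_comm, inv_mul_cancel_left, (htx.inv_right).symm.left_comm,
    inv_mul_cancel, mul_one]

namespace ThetaSetting

variable (D : ThetaSetting p)

/-- `θ(x)` for geometric `x` lies in the image of `Δ^tp_X`. [cite: MochizukiEtTh2009, §1 p.12] -/
theorem toTheta_mem_map_of_mem_deltaTemp {x : D.PiTemp} (hx : x ∈ D.DeltaTemp) :
    D.toTheta x ∈ (D.aug.toMonoidHom.ker).map D.toTheta :=
  Subgroup.mem_map_of_mem _ hx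

end ThetaSetting

namespace MuTwoSetting.CLevelData

variable {M : MuTwoSetting p} (e : M.CLevelData)

/-! ## Bookkeeping on the restricted inner automorphisms `conjX g` -/

/-- `conjX (g h) = conjX g ∘ conjX h`. [cite: MochizukiEtTh2009, Prop 1.8 p.28] -/
theorem conjX_mul (g h : M.GtpC) (x : M.PiTemp) : e.conjX (g * h) x = e.conjX g (e.conjX h x) :=
  M.injective_inclX (by simp only [e.inclX_conjX, mul_assoc, mul_inv_rev])

/-- `conjX 1 = id`. [cite: MochizukiEtTh2009, Prop 1.8 p.28] -/
theorem conjX_one (x : M.PiTemp) : e.conjX 1 x = x :=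
  M.injective_inclX (by rw [e.inclX_conjX, one_mul, inv_one, mul_one])

/-- `inclX ((conjX g)⁻¹ x) = g⁻¹ · inclX x · g`. [cite: MochizukiEtTh2009, Prop 1.8 p.28] -/
theorem inclX_conjX_symm (g : M.GtpC) (x : M.PiTemp) :
    M.inclX ((e.conjX g).symm x) = g⁻¹ * M.inclX x * g := by
  have h := e.inclX_conjX g ((e.conjX g).symm x)
  rw [ContinuousMulEquiv.apply_symm_apply] at h
  rw [h]; group

/-- `(conjX g)⁻¹ = conjX g⁻¹`. [cite: MochizukiEtTh2009, Prop 1.8 p.28] -/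
theorem conjX_symm_apply (g : M.GtpC) (x : M.PiTemp) : (e.conjX g).symm x = e.conjX g⁻¹ x :=
  M.injective_inclX (by rw [e.inclX_conjX_symm, e.inclX_conjX, inv_inv])

/-- `Ker(Π^tp_X ↠ (Π^tp_X)^Θ)` is stable under every `conjX g` (`map_ker_toTheta_eq`). [cite: MochizukiEtTh2009, Def 2.7 p.41] -/
theorem conjX_mem_ker_toTheta {g : M.GtpC} {k : M.PiTemp} (hk : k ∈ M.toTheta.ker) :
    e.conjX g k ∈ M.toTheta.ker := by
  have h : e.conjX g k ∈ M.toTheta.ker.map (e.conjX g).toMulEquiv.toMonoidHom := ⟨k, hk, rfl⟩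
  rwa [M.toThetaSetting.map_ker_toTheta_eq (e.conjX g) (e.map_deltaTemp_conjX g)] at h

/-- The inverse image of `l·Δ_Θ` is stable under every `conjX g` (`map_comap_lDeltaTheta_eq`). [cite: MochizukiEtTh2009, Cor 2.18 (i) p.60] -/
theorem conjX_mem_comap_lDeltaTheta (l : ℕ) {g : M.GtpC} {x : M.PiTemp}
    (hx : x ∈ (M.lDeltaTheta l).comap M.toTheta) : e.conjX g x ∈ (M.lDeltaTheta l).comap M.toTheta := by
  have h : e.conjX g x ∈ ((M.lDeltaTheta l).comap M.toTheta).map (e.conjX g).toMulEquiv.toMonoidHom :=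
    ⟨x, hx, rfl⟩
  rwa [M.toThetaSetting.map_comap_lDeltaTheta_eq l (e.conjX g) (e.map_deltaTemp_conjX g)] at h

/-! ## `Δ^tp_C` acts trivially on `Δ_Θ`-valued commutators -/

/-- **A GEOMETRIC element of `Π^tp_C` fixes `θ(z b z⁻¹ b⁻¹)` for `z, b ∈ Δ^tp_X`.** For `g ∈ Δ^tp_X` this is the
centrality of `Δ_Θ` in `(Δ^tp_X)^Θ`; for `g ∉ Π^tp_X` (a lift of the inversion) it follows from «`g` acts by `−1`
on `(Δ^tp_X)^ell`» (census predicate C4 at `g`, hypothesis) by `[u x⁻¹, v y⁻¹] = [x, y]` — i.e. the inversion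
acts with eigenvalue `+1` on `Δ_Θ = [Δ^Θ_X, Δ^Θ_X]`. [cite: MochizukiEtTh2009, Prop 2.2 (i) p.37] -/
theorem toTheta_conjX_commutator_eq {g : M.GtpC} (hg1 : e.augC g = 1)
    (hinv : g ∉ M.inclX.range → M.InvActsByNegOnEllAt g)
    {z b : M.PiTemp} (hz : z ∈ M.DeltaTemp) (hb : b ∈ M.DeltaTemp) :
    M.toTheta (e.conjX g (z * b * z⁻¹ * b⁻¹)) = M.toTheta (z * b * z⁻¹ * b⁻¹) := by
  have ht : M.toTheta (z * b * z⁻¹ * b⁻¹) ∈ M.DeltaTheta :=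
    M.toThetaSetting.toTheta_commutator_mem_deltaTheta hz hb
  by_cases hg : g ∈ M.inclX.range
  · -- `g = inclX x` with `x ∈ Δ^tp_X`: centrality
    obtain ⟨x, rfl⟩ := hg
    have hx : x ∈ M.DeltaTemp := by
      change M.aug.toMonoidHom x = 1
      change M.aug x = 1
      rw [← e.augC_inclX]; exact hg1
    rw [e.conjX_inclX, map_mul, map_mul, map_inv]
    have hc := M.ker_thetaToEll_central _ ht _ (M.toThetaSetting.toTheta_mem_map_of_mem_deltaTemp hx)
    rw [← hc, mul_inv_cancel_right]
  · -- `g ∉ Π^tp_X`: eigenvalue `−1` on `Δ^ell` forces `+1` on the commutators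
    have hneg := hinv hg
    have hgz : e.conjX g z ∈ M.DeltaTemp := (e.conjX_mem_deltaTemp_iff g z).2 hz
    have hgb : e.conjX g b ∈ M.DeltaTemp := (e.conjX_mem_deltaTemp_iff g b).2 hb
    -- `u := θ(gz)·θz`, `v := θ(gb)·θb` lie in `Δ_Θ`
    have hu : M.toTheta (e.conjX g z) * M.toTheta z ∈ M.DeltaTheta := by
      change M.thetaToEll _ = 1
      rw [map_mul]
      have h := hneg z hz
      change M.thetaToEll (M.toTheta (e.conjX g z)) = _ at h
      rw [h, inv_mul_cancel]
    have hv : M.toTheta (e.conjX g b) * M.toTheta b ∈ M.DeltaTheta := by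
      change M.thetaToEll _ = 1
      rw [map_mul]
      have h := hneg b hb
      change M.thetaToEll (M.toTheta (e.conjX g b)) = _ at h
      rw [h, inv_mul_cancel]
    set u := M.toTheta (e.conjX g z) * M.toTheta z with hudef
    set v := M.toTheta (e.conjX g b) * M.toTheta b with hvdef
    have huz : M.toTheta (e.conjX g z) = u * (M.toTheta z)⁻¹ := by rw [hudef, mul_inv_cancel_right]
    have hvb : M.toTheta (e.conjX g b) = v * (M.toTheta b)⁻¹ := by rw [hvdef, mul_inv_cancel_right]
    have hθz := M.toThetaSetting.toTheta_mem_map_of_mem_deltaTemp hz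
    have hθb := M.toThetaSetting.toTheta_mem_map_of_mem_deltaTemp hb
    have ht' : M.toTheta z * M.toTheta b * (M.toTheta z)⁻¹ * (M.toTheta b)⁻¹ ∈ M.DeltaTheta := by
      simpa only [map_mul, map_inv] using ht
    simp only [map_mul, map_inv]
    rw [huz, hvb]
    exact commutator_central_twist_inv
      (M.ker_thetaToEll_central _ hu _ hθz) (M.ker_thetaToEll_central _ hu _ hθb)
      (M.ker_thetaToEll_central _ hv _ hθz) (M.ker_thetaToEll_central _ hv _ hθb)
      (M.ker_thetaToEll_comm _ hu _ hv)
      (M.ker_thetaToEll_central _ ht' _ hθz) (M.ker_thetaToEll_central _ ht' _ hθb)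

/-- The same with a trailing factor from `Ker(Π^tp_X ↠ (Π^tp_X)^Θ)` (the HEISENBERG normal form
`z b z⁻¹ b⁻¹ k` of an element over `l·Δ_Θ`, [EtTh] Prop. 2.12 (i)). [cite: MochizukiEtTh2009, Prop 2.12 (i) p.45] -/
theorem toTheta_conjX_eq_of_heisenberg {g : M.GtpC} (hg1 : e.augC g = 1)
    (hinv : g ∉ M.inclX.range → M.InvActsByNegOnEllAt g) {w : M.PiTemp}
    (hw : ∃ z ∈ M.DeltaTemp, ∃ b ∈ M.DeltaTemp, ∃ k ∈ M.toTheta.ker, w = z * b * z⁻¹ * b⁻¹ * k) :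
    M.toTheta (e.conjX g w) = M.toTheta w := by
  obtain ⟨z, hz, b, hb, k, hk, rfl⟩ := hw
  have hk' : M.toTheta (e.conjX g k) = 1 := e.conjX_mem_ker_toTheta hk
  have hk1 : M.toTheta k = 1 := hk
  rw [map_mul (e.conjX g), map_mul M.toTheta, hk', mul_one, map_mul M.toTheta, hk1, mul_one]
  exact e.toTheta_conjX_commutator_eq hg1 hinv hz hb

/-- **The cyclotomic character.** For EVERY `g ∈ Π^tp_C` and every `w` over `l·Δ_Θ` in Heisenberg normal form,
`(l·Δ_Θ) ↠ (l·Δ_Θ) ⊗ ℤ/N = μ_N` carries `θ(g w g⁻¹)` to `χ(augC g) · red(θ w)` — split `g = g₀ · inclX x` with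
`g₀` geometric (`augC(Π^tp_C) = G_K = aug(Π^tp_X)`), use the triviality for `g₀` and the `Π^tp_X`-equivariance
`red_conj` of the cyclotome datum for `x`. [cite: MochizukiEtTh2009, Cor 2.19 (i) p.64] -/
theorem red_toTheta_conjX_eq {l : ℕ} {N : ℕ+} (μ : M.toThetaSetting.CyclotomeMod l N)
    (hinv : e.InvActsByNegOnEll) (g : M.GtpC) {w : M.PiTemp} (hwL : M.toTheta w ∈ M.lDeltaTheta l)
    (hw : ∃ z ∈ M.DeltaTemp, ∃ b ∈ M.DeltaTemp, ∃ k ∈ M.toTheta.ker, w = z * b * z⁻¹ * b⁻¹ * k)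
    (hgwL : M.toTheta (e.conjX g w) ∈ M.lDeltaTheta l) :
    μ.red ⟨M.toTheta (e.conjX g w), hgwL⟩ = galMuN p N (e.augC g) (μ.red ⟨M.toTheta w, hwL⟩) := by
  -- an `x ∈ Π^tp_X` with the same image in `G_K`
  obtain ⟨x, hx⟩ : ∃ x : M.PiTemp, M.aug.toMonoidHom x = e.augC g := by
    have h : e.augC g ∈ M.aug.toMonoidHom.range := by
      rw [M.range_aug]; exact e.augC_mem_GK g
    exact h
  set g₀ := g * (M.inclX x)⁻¹ with hg₀
  have hg₀1 : e.augC g₀ = 1 := by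
    rw [hg₀, map_mul, map_inv, e.augC_inclX]
    change e.augC g * (M.aug.toMonoidHom x)⁻¹ = 1
    rw [hx, mul_inv_cancel]
  have hgeq : g = g₀ * M.inclX x := by rw [hg₀, inv_mul_cancel_right]
  -- the Heisenberg form of `x w x⁻¹`
  obtain ⟨z, hz, b, hb, k, hk, rfl⟩ := hw
  have hw' : ∃ z' ∈ M.DeltaTemp, ∃ b' ∈ M.DeltaTemp, ∃ k' ∈ M.toTheta.ker,
      e.conjX (M.inclX x) (z * b * z⁻¹ * b⁻¹ * k) = z' * b' * z'⁻¹ * b'⁻¹ * k' :=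
    ⟨e.conjX (M.inclX x) z, (e.conjX_mem_deltaTemp_iff _ z).2 hz, e.conjX (M.inclX x) b,
      (e.conjX_mem_deltaTemp_iff _ b).2 hb, e.conjX (M.inclX x) k, e.conjX_mem_ker_toTheta hk,
      by simp only [map_mul, map_inv]⟩
  have key : M.toTheta (e.conjX g (z * b * z⁻¹ * b⁻¹ * k)) =
      M.toTheta x * M.toTheta (z * b * z⁻¹ * b⁻¹ * k) * (M.toTheta x)⁻¹ := by
    rw [hgeq, e.conjX_mul, e.toTheta_conjX_eq_of_heisenberg hg₀1 (fun h => (e.invActsByNegOnEll_iff).1 hinv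
      g₀ hg₀1 h) hw', e.conjX_inclX, map_mul, map_mul, map_inv]
  have hmem : M.toTheta x * M.toTheta (z * b * z⁻¹ * b⁻¹ * k) * (M.toTheta x)⁻¹ ∈ M.lDeltaTheta l :=
    (M.toThetaSetting.lDeltaTheta_normal l).conj_mem _ hwL _
  have hsub : (⟨M.toTheta (e.conjX g (z * b * z⁻¹ * b⁻¹ * k)), hgwL⟩ : M.lDeltaTheta l) =
      ⟨M.toTheta x * M.toTheta (z * b * z⁻¹ * b⁻¹ * k) * (M.toTheta x)⁻¹, hmem⟩ := Subtype.ext key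
  rw [hsub, μ.red_conj x ⟨_, hwL⟩, hx]

end MuTwoSetting.CLevelData

/-! ## At the model `R := C.rigidData μ hC hS h15 L` of `X̲̲` -/

namespace ThetaSetting.EtaleThetaData.DoubleUnderline

variable {Mt : MuTwoSetting p} {E : Mt.toThetaSetting.EtaleThetaData} {l : ℕ} (C : E.DoubleUnderline l)
  {N : ℕ+} (μ : Mt.toThetaSetting.CyclotomeMod l N) (hC : Mt.toThetaSetting.Compat)
  (hS : Mt.toThetaSetting.Sec2Hyps) (h15 : Prop15iii E hC) (L : C.CuspLabels)

/-- Under `Ker(Π^tp_X ↠ (Π^tp_X)^Θ) ≤ Π^tp_X̲̲` the whole inverse image of `l·Δ_Θ` lies in `Π^tp_X̲̲` (root clause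
`map_toTheta_Huu : θ(Π^tp_X̲̲) ∩ Δ_Θ = l·Δ_Θ`). [cite: MochizukiEtTh2009, Prop 2.12 (i) p.45] -/
theorem comap_lDeltaTheta_le_Huu (hker : Mt.toTheta.ker ≤ C.Huu) :
    (Mt.lDeltaTheta l).comap Mt.toTheta ≤ C.Huu := by
  intro x hx
  rw [Subgroup.mem_comap] at hx
  have hx' : Mt.toTheta x ∈ C.Huu.map Mt.toTheta ⊓ Mt.DeltaTheta := by
    rw [C.map_toTheta_Huu]; exact hx
  obtain ⟨⟨h, hh, hhx⟩, -⟩ := hx'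
  have hk : h⁻¹ * x ∈ Mt.toTheta.ker := by
    rw [MonoidHom.mem_ker, map_mul, map_inv, hhx, inv_mul_cancel]
  have := C.Huu.mul_mem hh (hker hk)
  rwa [mul_inv_cancel_left] at this

/-- The `(l·Δ_Θ)`-preimage of the model rigid data, read in `Π^tp_X`: membership is `θ(t) ∈ l·Δ_Θ`.
[cite: MochizukiEtTh2009, Cor 2.18 p.59] -/
theorem mem_rigidData_lDeltaTheta_iff (t : C.Huu) :
    t ∈ (C.rigidData μ hC hS h15 L).lDeltaTheta ↔ Mt.toTheta (t : Mt.PiTemp) ∈ Mt.lDeltaTheta l := Iff.rfl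

/-- **Heisenberg normal form in `Π^tp_X`** (abc-iut-L2-t8/L5-t14's `rigidData_hcomm_of_origin`, coerced): every
element of the `(l·Δ_Θ)`-preimage of `X̲̲` is `z b z⁻¹ b⁻¹ k` with `z, b ∈ Δ^tp_X`, `k ∈ Ker(↠ Θ)`.
[cite: MochizukiEtTh2009, Prop 2.12 (i) p.45] -/
theorem exists_heisenberg_of_mem_lDeltaTheta (hO : Mt.toThetaSetting.IsEtThOrigin)
    (hYcl : (Mt.DtpY.map Mt.toHat.toMonoidHom).topologicalClosure ≤
      Mt.DtpY.map Mt.toHat.toMonoidHom ⊔ (⁅⁅Mt.DeltaHat, Mt.DeltaHat⁆, Mt.DeltaHat⁆).topologicalClosure)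
    (t : C.Huu) (ht : t ∈ (C.rigidData μ hC hS h15 L).lDeltaTheta) :
    ∃ z ∈ Mt.DeltaTemp, ∃ b ∈ Mt.DeltaTemp, ∃ k ∈ Mt.toTheta.ker,
      (t : Mt.PiTemp) = z * b * z⁻¹ * b⁻¹ * k := by
  obtain ⟨z, hz, b, hb, k, hk, htz⟩ := (C.rigidData_hcomm_of_origin μ hC hS h15 L hO hYcl t).1 ht
  rw [C.rigidData_aug_ker μ hC hS h15 L, Subgroup.mem_subgroupOf] at hz
  have hb' : (b : Mt.PiTemp) ∈ Mt.DeltaTemp := by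
    have h2 : b ∈ (C.rigidData μ hC hS h15 L).aug.ker := (Subgroup.mem_inf.1 hb).2
    rw [C.rigidData_aug_ker μ hC hS h15 L, Subgroup.mem_subgroupOf] at h2
    exact h2
  rw [C.rigidData_thetaKer μ hC hS h15 L, Subgroup.mem_subgroupOf] at hk
  refine ⟨z, hz, b, hb', k, hk, ?_⟩
  rw [htz]
  simp only [Subgroup.coe_mul, Subgroup.coe_inv]

/-- **`Δ^tp_C` ACTS TRIVIALLY ON `l·Δ_Θ`** (at the model of `X̲̲`): for geometric `g ∈ Π^tp_C` and `t` in the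
`(l·Δ_Θ)`-preimage, `θ(g t g⁻¹) = θ(t)` — [IUTchII] Rmk. 1.1.1 (iv)'s «factors through `Π_C(M) ↠ G(M)`» on the
`l·Δ_Θ`-coordinate. Inputs BY NAME: census C4 (`InvActsByNegOnEll`), `IsEtThOrigin`, `hYcl`.
[cite: MochizukiEtTh2009, Prop 2.2 (i) p.37] -/
theorem toTheta_conjX_eq_of_mem_lDeltaTheta (cl : Mt.CLevelData) (hinv : cl.InvActsByNegOnEll)
    (hO : Mt.toThetaSetting.IsEtThOrigin)
    (hYcl : (Mt.DtpY.map Mt.toHat.toMonoidHom).topologicalClosure ≤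
      Mt.DtpY.map Mt.toHat.toMonoidHom ⊔ (⁅⁅Mt.DeltaHat, Mt.DeltaHat⁆, Mt.DeltaHat⁆).topologicalClosure)
    {g : Mt.GtpC} (hg1 : cl.augC g = 1) (t : C.Huu) (ht : t ∈ (C.rigidData μ hC hS h15 L).lDeltaTheta) :
    Mt.toTheta (cl.conjX g (t : Mt.PiTemp)) = Mt.toTheta (t : Mt.PiTemp) :=
  cl.toTheta_conjX_eq_of_heisenberg hg1 (fun h => (cl.invActsByNegOnEll_iff).1 hinv g hg1 h)
    (C.exists_heisenberg_of_mem_lDeltaTheta μ hC hS h15 L hO hYcl t ht)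

/-- Membership: `conjX g` carries the `(l·Δ_Θ)`-preimage of `X̲̲` into `Π^tp_X̲̲` (under `hker`).
[cite: MochizukiEtTh2009, Cor 2.18 (i) p.60] -/
theorem conjX_mem_Huu_of_mem_lDeltaTheta (cl : Mt.CLevelData) (hker : Mt.toTheta.ker ≤ C.Huu) (g : Mt.GtpC)
    (t : C.Huu) (ht : t ∈ (C.rigidData μ hC hS h15 L).lDeltaTheta) :
    cl.conjX g (t : Mt.PiTemp) ∈ C.Huu :=
  C.comap_lDeltaTheta_le_Huu hker (cl.conjX_mem_comap_lDeltaTheta l (Subgroup.mem_comap.2 ht))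

/-- … and keeps it inside the `(l·Δ_Θ)`-preimage. [cite: MochizukiEtTh2009, Cor 2.18 (i) p.60] -/
theorem conjX_mem_lDeltaTheta (cl : Mt.CLevelData) (hker : Mt.toTheta.ker ≤ C.Huu) (g : Mt.GtpC)
    (t : C.Huu) (ht : t ∈ (C.rigidData μ hC hS h15 L).lDeltaTheta) :
    (⟨cl.conjX g (t : Mt.PiTemp), C.conjX_mem_Huu_of_mem_lDeltaTheta μ hC hS h15 L cl hker g t ht⟩ : C.Huu) ∈
      (C.rigidData μ hC hS h15 L).lDeltaTheta :=
  Subgroup.mem_comap.1 (cl.conjX_mem_comap_lDeltaTheta l (Subgroup.mem_comap.2 ht))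

/-- … and inside `Π^tp_Y` (no (R1c) needed here: the preimage of `Δ_Θ` lies in `Ker(↠ Z)`).
[cite: MochizukiEtTh2009, Prop 1.5 (ii) p.23] -/
theorem conjX_mem_GtpY_of_mem_lDeltaTheta (cl : Mt.CLevelData) (g : Mt.GtpC) (t : C.Huu)
    (ht : t ∈ (C.rigidData μ hC hS h15 L).lDeltaTheta) : cl.conjX g (t : Mt.PiTemp) ∈ Mt.GtpY := by
  have h := cl.conjX_mem_comap_lDeltaTheta l (g := g) (Subgroup.mem_comap.2 ht)
  rw [Subgroup.mem_comap] at h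
  refine Mt.toThetaSetting.ker_toEll_le_GtpY ?_
  rw [MonoidHom.mem_ker, MonoidHom.comp_apply]
  exact Mt.toThetaSetting.lDeltaTheta_le l h

/-- Membership for the theta kernel: `conjX g` keeps `Ker(Π^tp_X̲̲ → (Π^tp_X)^Θ)` (under `hker`).
[cite: MochizukiEtTh2009, Cor 2.18 (i) p.60] -/
theorem conjX_mem_Huu_of_mem_thetaKer (cl : Mt.CLevelData) (hker : Mt.toTheta.ker ≤ C.Huu) (g : Mt.GtpC)
    (t : C.Huu) (ht : t ∈ (C.rigidData μ hC hS h15 L).thetaKer) :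
    cl.conjX g (t : Mt.PiTemp) ∈ C.Huu ∧ cl.conjX g (t : Mt.PiTemp) ∈ Mt.toTheta.ker := by
  rw [C.rigidData_thetaKer μ hC hS h15 L, Subgroup.mem_subgroupOf] at ht
  exact ⟨hker (cl.conjX_mem_ker_toTheta ht), cl.conjX_mem_ker_toTheta ht⟩

/-- **THE CYCLOTOMIC CHARACTER ON `Π^tp_C`** (at the model of `X̲̲`): for EVERY `g ∈ Π^tp_C` and `t` in the
`(l·Δ_Θ)`-preimage, the identification `thetaMod : (l·Δ_Θ) ↠ μ_N` of the rigid data satisfies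
`thetaMod(g t g⁻¹) = χ(augC g) · thetaMod(t)` — [IUTchII] Rmk. 1.1.1 (iv) «coincides with the action of `G(M)` via
the cyclotomic character». Inputs BY NAME: census C4, `IsEtThOrigin`, `hYcl`, `hker`.
[cite: MochizukiEtTh2009, Cor 2.19 (i) p.64] -/
theorem thetaMod_conjX_eq (cl : Mt.CLevelData) (hinv : cl.InvActsByNegOnEll)
    (hO : Mt.toThetaSetting.IsEtThOrigin)
    (hYcl : (Mt.DtpY.map Mt.toHat.toMonoidHom).topologicalClosure ≤
      Mt.DtpY.map Mt.toHat.toMonoidHom ⊔ (⁅⁅Mt.DeltaHat, Mt.DeltaHat⁆, Mt.DeltaHat⁆).topologicalClosure)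
    (hker : Mt.toTheta.ker ≤ C.Huu) (g : Mt.GtpC) (t : C.Huu) (ht : t ∈ (C.rigidData μ hC hS h15 L).lDeltaTheta) :
    (C.rigidData μ hC hS h15 L).thetaMod
        ⟨⟨cl.conjX g (t : Mt.PiTemp), C.conjX_mem_Huu_of_mem_lDeltaTheta μ hC hS h15 L cl hker g t ht⟩,
          C.conjX_mem_lDeltaTheta μ hC hS h15 L cl hker g t ht⟩ =
      galMuN p N (cl.augC g) ((C.rigidData μ hC hS h15 L).thetaMod ⟨t, ht⟩) := by
  have hw := C.exists_heisenberg_of_mem_lDeltaTheta μ hC hS h15 L hO hYcl t ht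
  have hgL : Mt.toTheta (cl.conjX g (t : Mt.PiTemp)) ∈ Mt.lDeltaTheta l :=
    Subgroup.mem_comap.1 (cl.conjX_mem_comap_lDeltaTheta l (g := g) (Subgroup.mem_comap.2 ht))
  have h := cl.red_toTheta_conjX_eq μ hinv g ht hw hgL
  change μ.red (C.toLDelta _) = galMuN p N (cl.augC g) (μ.red (C.toLDelta _))
  have e1 : C.toLDelta ⟨⟨cl.conjX g (t : Mt.PiTemp), C.conjX_mem_Huu_of_mem_lDeltaTheta μ hC hS h15 L cl
      hker g t ht⟩, C.conjX_mem_lDeltaTheta μ hC hS h15 L cl hker g t ht⟩ =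
      ⟨Mt.toTheta (cl.conjX g (t : Mt.PiTemp)), hgL⟩ := Subtype.ext rfl
  have e2 : C.toLDelta ⟨t, ht⟩ = ⟨Mt.toTheta (t : Mt.PiTemp), ht⟩ := Subtype.ext rfl
  rw [e1, e2]
  exact h

end ThetaSetting.EtaleThetaData.DoubleUnderline

end Literature.AnabelianGeometry.EtaleTheta

end
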